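import Summits.Ventures.CertifiedManyBodySolver.Observables.SourcedGibbsTrialCapSqEigen
import HarnessLib

/-!
# The HF–BCS sourced cap in momentum space (XI): the Fermi function on a PAIR of vectors closed under the square
# (`A²v = a v + b w`, `A²w = b v + a' w`) — the `2 × 2` spectral split feeding `fermi_mulVec_of_sq_eigen`

HONEST FRAMING: zero compute; PROVED identities of finite-dimensional linear algebra; no number is claimed. Generic in the
Hermitian matrix `A`. In the antiferromagnetic + `d`-wave-pinned chain (`SourcedGibbsTrialCapAFSymbol.lean`, file (X)) the
pair is `(χ_p ⊗ e_τ, χ_{p+Q} ⊗ e_τ)` with `a = ξ_p² + g_p² + M²`, `a' = ξ_{p+Q}² + g_p² + M²`, `b = ∓2μ'M`; the two square-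
eigenvalues are `E_±(p)² = (√(ε_p² + M²) ± μ')² + g_p²`. Not a statement about order; not a superconductivity verdict.

Cell `hubbard-obs` (D-0042 / D-0082), seat `hubbard-obs-pin-2` (`prover-hubbard-obs-pin-2-g7-0`).

## Contents (`A` Hermitian; `a, a', b` real; `m = (a + a')/2`, `r = √(((a − a')/2)² + b²)`, `λ_± = m ± r`)

* `sq_pair_apply_sq` — `A²(A²v) = (a² + b²) v + b(a + a') w` (Cayley–Hamilton data of the pair).
* `sq_eigen_of_sq_pair_plus/minus` — the spectral components `v_± = ½v ± (1/(2r))(A²v − m v)` satisfy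
  `A²v_± = λ_± v_±` (at `r = 0`: `b = 0`, `a = a'`, `v_± = ½v`).
* `fermi_mulVec_of_sq_pair` — **`(1 + e^{βA})⁻¹ v = ½v − Q(E₊)·A v₊ − Q(E₋)·A v₋`**, `E_± = √λ_±`, `Q(E) = tanh(βE/2)/(2E)`,
  under `0 ≤ a + a'` and `b² ≤ a a'` (so `λ_± ≥ 0`); file (IX) on each component.

References: von Delft–Ralph, Phys. Rep. 345 (2001) 61, §4.2 [VondelftRalph2001]; Bach–Lieb–Solovej, J. Stat. Phys. 76
(1994) 3, §2 [BachLiebSolovej1994].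
-/

noncomputable section

open Matrix Finset Literature.MathematicalPhysics.QuantumLattice Literature.Probability.LatticeModels
open scoped ComplexConjugate ComplexOrder

namespace Summit.Ventures.CertifiedManyBodySolver.Observables

section SqPair

variable {n : Type*} [Fintype n] [DecidableEq n]

omit [DecidableEq n] in
/-- Iterating the pair relation: `A²(A²v) = (a² + b²)·v + b(a + a')·w`. [folklore] -/
theorem sq_pair_apply_sq {A : Matrix n n ℂ} {v w : n → ℂ} {a a' b : ℝ}
    (hv : A *ᵥ (A *ᵥ v) = (a : ℂ) • v + (b : ℂ) • w) (hw : A *ᵥ (A *ᵥ w) = (b : ℂ) • v + (a' : ℂ) • w) :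
    A *ᵥ (A *ᵥ (A *ᵥ (A *ᵥ v))) = ((a ^ 2 + b ^ 2 : ℝ) : ℂ) • v + ((b * (a + a') : ℝ) : ℂ) • w := by
  rw [hv, Matrix.mulVec_add, Matrix.mulVec_smul, Matrix.mulVec_smul, Matrix.mulVec_add, Matrix.mulVec_smul,
    Matrix.mulVec_smul, hv, hw]
  ext i
  simp only [Pi.add_apply, Pi.smul_apply, smul_eq_mul]
  push_cast
  ring

omit [DecidableEq n] in
/-- **Spectral component `+`**: with `m = (a+a')/2`, `r = √(((a−a')/2)² + b²)`,
`v₊ = ½v + (1/(2r))(A²v − m v)` satisfies `A²v₊ = (m + r) v₊` (also at `r = 0`, where `b = 0`, `a = a'`).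
[cite: VondelftRalph2001, §4.2] -/
theorem sq_eigen_of_sq_pair_plus {A : Matrix n n ℂ} {v w : n → ℂ} {a a' b : ℝ}
    (hv : A *ᵥ (A *ᵥ v) = (a : ℂ) • v + (b : ℂ) • w) (hw : A *ᵥ (A *ᵥ w) = (b : ℂ) • v + (a' : ℂ) • w) :
    A *ᵥ (A *ᵥ (((1 / 2 : ℝ) : ℂ) • v +
        ((1 / (2 * Real.sqrt (((a - a') / 2) ^ 2 + b ^ 2)) : ℝ) : ℂ) • (A *ᵥ (A *ᵥ v) - (((a + a') / 2 : ℝ) : ℂ) • v))) =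
      (((a + a') / 2 + Real.sqrt (((a - a') / 2) ^ 2 + b ^ 2) : ℝ) : ℂ) •
        (((1 / 2 : ℝ) : ℂ) • v +
          ((1 / (2 * Real.sqrt (((a - a') / 2) ^ 2 + b ^ 2)) : ℝ) : ℂ) • (A *ᵥ (A *ᵥ v) - (((a + a') / 2 : ℝ) : ℂ) • v)) := by
  set r := Real.sqrt (((a - a') / 2) ^ 2 + b ^ 2) with hr
  have hr2 : r ^ 2 = ((a - a') / 2) ^ 2 + b ^ 2 := Real.sq_sqrt (by positivity)
  have h4 := sq_pair_apply_sq hv hw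
  rw [Matrix.mulVec_add, Matrix.mulVec_smul, Matrix.mulVec_smul, Matrix.mulVec_sub, Matrix.mulVec_smul,
    Matrix.mulVec_add, Matrix.mulVec_smul, Matrix.mulVec_smul, Matrix.mulVec_sub, Matrix.mulVec_smul, h4, hv]
  -- the two scalar coefficient identities (in `ℝ`)
  have ev : (1 / 2 : ℝ) * a + 1 / (2 * r) * ((a ^ 2 + b ^ 2) - (a + a') / 2 * a) =
      ((a + a') / 2 + r) * (1 / 2 + 1 / (2 * r) * (a - (a + a') / 2)) := by
    rcases eq_or_ne r 0 with hr0 | hr0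
    · rw [hr0] at hr2
      have hb : b = 0 := by nlinarith [sq_nonneg b, sq_nonneg ((a - a') / 2)]
      have haa : a = a' := by nlinarith [sq_nonneg b, sq_nonneg ((a - a') / 2)]
      rw [hr0, hb, haa]; ring
    · have hc : 1 / (2 * r) * r = 1 / 2 := by field_simp
      linear_combination (-(1 / (2 * r))) * hr2 + (r - (a - (a + a') / 2)) * hc
  have ew : (1 / 2 : ℝ) * b + 1 / (2 * r) * (b * (a + a') - (a + a') / 2 * b) =
      ((a + a') / 2 + r) * (1 / (2 * r) * b) := by
    rcases eq_or_ne r 0 with hr0 | hr0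
    · rw [hr0] at hr2
      have hb : b = 0 := by nlinarith [sq_nonneg b, sq_nonneg ((a - a') / 2)]
      rw [hr0, hb]; ring
    · have hc : 1 / (2 * r) * r = 1 / 2 := by field_simp
      linear_combination (-b) * hc
  have ev' := congrArg (fun t : ℝ => (t : ℂ)) ev
  have ew' := congrArg (fun t : ℝ => (t : ℂ)) ew
  push_cast at ev' ew'
  ext i
  simp only [Pi.add_apply, Pi.smul_apply, Pi.sub_apply, smul_eq_mul]
  push_cast
  linear_combination (v i) * ev' + (w i) * ew'

omit [DecidableEq n] in
/-- **Spectral component `−`**: `v₋ = ½v − (1/(2r))(A²v − m v)` satisfies `A²v₋ = (m − r) v₋`.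
[cite: VondelftRalph2001, §4.2] -/
theorem sq_eigen_of_sq_pair_minus {A : Matrix n n ℂ} {v w : n → ℂ} {a a' b : ℝ}
    (hv : A *ᵥ (A *ᵥ v) = (a : ℂ) • v + (b : ℂ) • w) (hw : A *ᵥ (A *ᵥ w) = (b : ℂ) • v + (a' : ℂ) • w) :
    A *ᵥ (A *ᵥ (((1 / 2 : ℝ) : ℂ) • v -
        ((1 / (2 * Real.sqrt (((a - a') / 2) ^ 2 + b ^ 2)) : ℝ) : ℂ) • (A *ᵥ (A *ᵥ v) - (((a + a') / 2 : ℝ) : ℂ) • v))) =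
      (((a + a') / 2 - Real.sqrt (((a - a') / 2) ^ 2 + b ^ 2) : ℝ) : ℂ) •
        (((1 / 2 : ℝ) : ℂ) • v -
          ((1 / (2 * Real.sqrt (((a - a') / 2) ^ 2 + b ^ 2)) : ℝ) : ℂ) • (A *ᵥ (A *ᵥ v) - (((a + a') / 2 : ℝ) : ℂ) • v)) := by
  set r := Real.sqrt (((a - a') / 2) ^ 2 + b ^ 2) with hr
  have hr2 : r ^ 2 = ((a - a') / 2) ^ 2 + b ^ 2 := Real.sq_sqrt (by positivity)
  have h4 := sq_pair_apply_sq hv hw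
  rw [Matrix.mulVec_sub, Matrix.mulVec_smul, Matrix.mulVec_smul, Matrix.mulVec_sub, Matrix.mulVec_smul,
    Matrix.mulVec_sub, Matrix.mulVec_smul, Matrix.mulVec_smul, Matrix.mulVec_sub, Matrix.mulVec_smul, h4, hv]
  have ev : (1 / 2 : ℝ) * a - 1 / (2 * r) * ((a ^ 2 + b ^ 2) - (a + a') / 2 * a) =
      ((a + a') / 2 - r) * (1 / 2 - 1 / (2 * r) * (a - (a + a') / 2)) := by
    rcases eq_or_ne r 0 with hr0 | hr0
    · rw [hr0] at hr2
      have hb : b = 0 := by nlinarith [sq_nonneg b, sq_nonneg ((a - a') / 2)]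
      have haa : a = a' := by nlinarith [sq_nonneg b, sq_nonneg ((a - a') / 2)]
      rw [hr0, hb, haa]; ring
    · have hc : 1 / (2 * r) * r = 1 / 2 := by field_simp
      linear_combination (1 / (2 * r)) * hr2 + (-(r + (a - (a + a') / 2))) * hc
  have ew : (1 / 2 : ℝ) * b - 1 / (2 * r) * (b * (a + a') - (a + a') / 2 * b) =
      ((a + a') / 2 - r) * (-(1 / (2 * r) * b)) := by
    rcases eq_or_ne r 0 with hr0 | hr0
    · rw [hr0] at hr2
      have hb : b = 0 := by nlinarith [sq_nonneg b, sq_nonneg ((a - a') / 2)]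
      rw [hr0, hb]; ring
    · have hc : 1 / (2 * r) * r = 1 / 2 := by field_simp
      linear_combination (-b) * hc
  have ev' := congrArg (fun t : ℝ => (t : ℂ)) ev
  have ew' := congrArg (fun t : ℝ => (t : ℂ)) ew
  push_cast at ev' ew'
  ext i
  simp only [Pi.add_apply, Pi.smul_apply, Pi.sub_apply, smul_eq_mul]
  push_cast
  linear_combination (v i) * ev' + (w i) * ew'

/-- **The Fermi function on a square-closed pair.** If `A` is Hermitian, `A²v = a v + b w`, `A²w = b v + a' w` with
`a + a' ≥ 0` and `b² ≤ a a'` (so that `λ_± = m ± r ≥ 0`), then with `E_± = √λ_±`, `Q(E) = tanh(βE/2)/(2E)` and the spectral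
components `v_±` of `sq_eigen_of_sq_pair_plus/minus`:
`(1 + e^{βA})⁻¹ v = ½·v − Q(E₊)·(A v₊) − Q(E₋)·(A v₋)`. [cite: VondelftRalph2001, §4.2] [cite: BachLiebSolovej1994, §2] -/
theorem fermi_mulVec_of_sq_pair {A : Matrix n n ℂ} (hA : A.IsHermitian) {v w : n → ℂ} (β : ℝ) {a a' b : ℝ}
    (hv : A *ᵥ (A *ᵥ v) = (a : ℂ) • v + (b : ℂ) • w) (hw : A *ᵥ (A *ᵥ w) = (b : ℂ) • v + (a' : ℂ) • w)
    (hsum : 0 ≤ a + a') (hdet : b ^ 2 ≤ a * a') :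
    (1 + NormedSpace.exp ((β : ℂ) • A))⁻¹ *ᵥ v =
      ((1 / 2 : ℝ) : ℂ) • v -
        ((Real.tanh (β * Real.sqrt ((a + a') / 2 + Real.sqrt (((a - a') / 2) ^ 2 + b ^ 2)) / 2) /
            (2 * Real.sqrt ((a + a') / 2 + Real.sqrt (((a - a') / 2) ^ 2 + b ^ 2))) : ℝ) : ℂ) •
          (A *ᵥ (((1 / 2 : ℝ) : ℂ) • v +
            ((1 / (2 * Real.sqrt (((a - a') / 2) ^ 2 + b ^ 2)) : ℝ) : ℂ) •
              (A *ᵥ (A *ᵥ v) - (((a + a') / 2 : ℝ) : ℂ) • v))) -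
        ((Real.tanh (β * Real.sqrt ((a + a') / 2 - Real.sqrt (((a - a') / 2) ^ 2 + b ^ 2)) / 2) /
            (2 * Real.sqrt ((a + a') / 2 - Real.sqrt (((a - a') / 2) ^ 2 + b ^ 2))) : ℝ) : ℂ) •
          (A *ᵥ (((1 / 2 : ℝ) : ℂ) • v -
            ((1 / (2 * Real.sqrt (((a - a') / 2) ^ 2 + b ^ 2)) : ℝ) : ℂ) •
              (A *ᵥ (A *ᵥ v) - (((a + a') / 2 : ℝ) : ℂ) • v))) := by
  set r := Real.sqrt (((a - a') / 2) ^ 2 + b ^ 2) with hr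
  set m := (a + a') / 2 with hm
  have hr2 : r ^ 2 = ((a - a') / 2) ^ 2 + b ^ 2 := Real.sq_sqrt (by positivity)
  have hr0 : 0 ≤ r := Real.sqrt_nonneg _
  -- `λ_± ≥ 0`
  have hm2 : r ^ 2 ≤ m ^ 2 := by rw [hr2, hm]; nlinarith
  have hmr : r ≤ m := by
    have hm0 : 0 ≤ m := by rw [hm]; linarith
    nlinarith
  have hlp : 0 ≤ m + r := by linarith
  have hlm : 0 ≤ m - r := by linarith
  set vp := ((1 / 2 : ℝ) : ℂ) • v + ((1 / (2 * r) : ℝ) : ℂ) • (A *ᵥ (A *ᵥ v) - ((m : ℝ) : ℂ) • v) with hvp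
  set vm := ((1 / 2 : ℝ) : ℂ) • v - ((1 / (2 * r) : ℝ) : ℂ) • (A *ᵥ (A *ᵥ v) - ((m : ℝ) : ℂ) • v) with hvm
  have hdecomp : v = vp + vm := by
    rw [hvp, hvm]; ext i; simp only [Pi.add_apply, Pi.smul_apply, Pi.sub_apply, smul_eq_mul]; push_cast; ring
  have hsqp : A *ᵥ (A *ᵥ vp) = (((Real.sqrt (m + r)) ^ 2 : ℝ) : ℂ) • vp := by
    rw [Real.sq_sqrt hlp, hvp]; exact sq_eigen_of_sq_pair_plus hv hw
  have hsqm : A *ᵥ (A *ᵥ vm) = (((Real.sqrt (m - r)) ^ 2 : ℝ) : ℂ) • vm := by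
    rw [Real.sq_sqrt hlm, hvm]; exact sq_eigen_of_sq_pair_minus hv hw
  have hp := fermi_mulVec_of_sq_eigen hA β (Real.sqrt_nonneg (m + r)) hsqp
  have hmi := fermi_mulVec_of_sq_eigen hA β (Real.sqrt_nonneg (m - r)) hsqm
  conv_lhs => rw [hdecomp, Matrix.mulVec_add, hp, hmi]
  rw [hvp, hvm]
  ext i
  simp only [Pi.add_apply, Pi.smul_apply, Pi.sub_apply, smul_eq_mul]
  push_cast
  ring

end SqPair

end Summit.Ventures.CertifiedManyBodySolver.Observables

end
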